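import Literature.AlgebraicGeometry.Milne1999.LefschetzInvolutionIsLefschetz
import HarnessLib

/-!
# Milne 1999, Cor. 4.5 ON THE POWERS `A^r` (the classes fixed by `L(A)` acting diagonally are the Lefschetz classes),
# Cor. 4.7 on `H¹` (`S(A^r) = S(A)`), and Prop. 4.8 (a) ⟺ (c) in full

Family `hodge`, layer `Literature/AlgebraicGeometry/Milne1999`, namespace `Literature.AlgebraicGeometry.Milne1999`
(D-0022). Theorems only: no definition, no named fact, no `sorry` (D-0026). Written for the cell `pub-hodge-ring2`
(Hodge ladder stage 3), seat `ring2-b06`, as the Literature-side input of the «`S(A^r) = S(A)` diagonally» step its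
absolute-Hodge / exterior lane had left open (`Summits/…/Ring2HypothesesDescentAbsoluteExteriorLefschetz`, "NOT obtained");
it completes an item the Milne-1999 lane (`pub-hodgecm2`, seat `lit-milne`) lists under "What is NOT here" —
Prop. 4.8 (c) ⇒ (a) ON THE POWERS (`LefschetzGroup`: "the half (c) ⇒ (a) on `A` itself") — from that lane's own
Cor. 4.7 on `H¹` (`exists_mem_unitaryCentralizerGroup_diagPow_eq` of `LefschetzInvolutionIsLefschetz`: every element of
`S(A^{a+1})(ℂ)` is a diagonal `u^{⊕(a+1)}`, `u ∈ S(A)(ℂ)`) and its Thm. 3.2 / Cor. 4.5 in `S(·)(ℂ)`-form.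

## Source read (held text `paper:doi-10-1215-s0012-7094-99-09620-5` = J. S. Milne, *Lefschetz classes on abelian
varieties*, Duke Math. J. 96 (1999) 639–675), verbatim

* §4, p. 659 [p0021 L24–L27]: "**Corollary 4.5.** For any abelian variety `A` and any `r ≥ 0`,
  `H^{2*}(A^r)(*)^{L(A)} = D_hom(A^r)_k`. Proof. In the last proof, it was noted that the statement becomes true when
  `L(A)` is replaced with `G(A)`." and [L28–L30] "The projection map `GL(V(A)) × 𝔾_m → 𝔾_m` defines a cocharacter of
  `L(A)`, which we denote `l(A)` (or just `l`). The theorem shows that the kernel of `l(A)`, regarded as a subgroup of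
  `GL(V(A))`, equals `S(A)`."
* §4, p. 659 [p0021 L42–L47]: "**Corollary 4.7.** An isogeny `A → A₁^{r₁} × ⋯ × A_s^{r_s}` with the `Aᵢ` simple and
  pairwise nonisogenous defines an isomorphism `(L(A), l(A)) → ∏ᵢ (L(Aᵢ), l(Aᵢ))`", with §1, p. 643 [p0005 L12–L13]:
  "For any positive integer `r`, `V(A^r) = rV(A)`, and the diagonal action of `C(A)` on `rV(A)` identifies `C(A)` with
  `C(A^r)` (as `k`-algebras with involution)."
* §4, p. 660 [p0022 L36–L47]: "Clearly `D_hom(A) ⊂ H(A)`, and so `L(A) ⊃ Hg(A)`. A Hodge class not in `D_hom(A)` will be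
  said to be exotic. **Proposition 4.8.** The following conditions on an abelian variety `A` are equivalent: (a) no power
  of `A` supports an exotic Hodge class; (b) `Hg(A) = L(A)`; (c) `Hg′(A) = S(A)`; Proof. The groups `Hg(A)` and `L(A)`
  are the largest algebraic subgroups of `GL(H₁(A)) × 𝔾_m` fixing respectively the Hodge classes and the Lefschetz
  classes on the powers of `A`, and conversely, these are precisely the classes fixed by the two groups. Hence
  `H(A^r) = D(A^r)` for all `r` ⟺ `Hg(A) = L(A)`."

## What is proved (the tree's carriers: `ℂ`-points, Betti cohomology of the complex points, everything read through
`H¹` and the Künneth families of `HodgeTheory/MotivatedGaloisGroup`)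

* §1 **Cor. 4.5 on the power `A^{a+1}`, through the group of `A`**: a class `x ∈ H^{2p}(A^{a+1}(ℂ); ℂ)` fixed by
  `⋀^{2p}(u^{⊕(a+1)})` for every `u ∈ S(A)(ℂ) = unitaryCentralizerGroup A h` (`0 < dim A`, `h ∈ B¹ ⊗ ℂ` with
  `h^{dim A} ≠ 0` and `Q_h` non-degenerate) is a Lefschetz class of `A^{a+1}`
  (`mem_divisorClassesSpan_powSucc_of_forall_diagPowExterior_apply_eq`: the lane's Cor. 4.7 on `H¹` — these automorphisms
  are ALL of `S(A^{a+1})(ℂ)` for the product polarization `Σᵢ prᵢ^* h` — and its Thm. 3.2 / Cor. 4.5 in `S(·)(ℂ)`-form ON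
  `A^{a+1}`, `mem_divisorClassesSpan_of_forall_mem_unitaryCentralizerGroup`).
* §2 **Cor. 4.5 FOR ALL `r`, Tannaka-free** — "conversely, these are precisely the classes fixed by [`L(A)`]" on every
  power: a class `x ∈ H^{2p}(A.X^{×(a+1)}(ℂ); ℂ)` fixed by the `a`-th member of the Künneth family of every
  `g ∈ specialLefschetzGroup (dim A) A.X` lies in `lefschetzPowClasses (dim A) A.X a p = D^p_hom(A^{a+1})_ℂ`
  (`mem_lefschetzPowClasses_of_forall_kunnethFamily_apply_eq`; the cited record
  `Milne1999_specialLefschetzGroup_invariants_le` of `Milne1999/LefschetzGroup`, discharged by the lane, is the case `a = 0`),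
  and the invariants are EXACTLY the Lefschetz classes (`setOf_forall_kunnethFamily_apply_eq_eq_lefschetzPowClasses`).
  Whence the criterion behind Prop. 4.8 for ANY system `T` of classes on the powers:
  **`S(A) ≤ Stab(T) ⟺ T ⊆ Lefschetz`** (`specialLefschetzGroup_le_powClassStabilizer_iff`,
  `powClassStabilizer_eq_specialLefschetzGroup_iff`).
* §3 **Prop. 4.8, (c) ⇒ (a) ON EVERY POWER and (a) ⟺ (c), (a) ⟺ (b) in full**
  (`AbelianVariety.forall_isDivisorGenerated_powSucc_of_hodgeGroup_eq_specialLefschetzGroup`,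
  `AbelianVariety.hodgeGroup_eq_specialLefschetzGroup_iff_forall_isDivisorGenerated`,
  `AbelianVariety.mumfordTateGroup_eq_lefschetzGroup_iff_forall_isDivisorGenerated`): `Hg′(A) = S(A)` iff no power of `A`
  supports an exotic Hodge class (`∀ a, IsDivisorGenerated (A.powSucc a)`, i.e. the tree's `IsStablyNondegenerate A` of
  `HodgeTheory/StablyNondegenerateProducts`, definitionally), and then every power of `A` satisfies the Hodge conjecture
  (`hodgeConjectureFor_powSucc_of_hodgeGroup_eq_specialLefschetzGroup`, via the tree's `hodgeConjectureFor_of_isDivisorGenerated`).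

## The proof of §2 (Milne's "conversely", on the carriers)

Let `x ∈ H^{2p}(A^{a+1})` be fixed by the Künneth families of all `g ∈ S(A)` (Tannaka-free). If `dim A = 0` every class of
even degree on `A^{a+1}` (dimension `0`) is Lefschetz (`mem_divisorClassesSpan_of_eq_zero_or_lt`). Otherwise let `h` be the
rational Kähler class of a projective embedding (`KaehlerRationalDatum`; `h ∈ B¹ ⊗ ℂ`, `h^{dim A} ≠ 0`, `Q_h` non-degenerate —
the lane's §7 lemmas). For `u ∈ S(A)(ℂ) = unitaryCentralizerGroup A h` the family `(⋀ᵏu)_k` lies in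
`specialLefschetzGroup (dim A) A.X` with Künneth family `⋀•(u^{⊕(b+1)})` (`exteriorPullbackEquiv_mem_specialLefschetzGroup`,
`isKunnethFamily_exteriorKunnethFamily`, Thm. 4.4 `⊇`), so `x` is fixed by `⋀^{2p}(u^{⊕(a+1)})` for all such `u`; by the
lane's Cor. 4.7 on `H¹` these are ALL of `S(A^{a+1})(ℂ)` for Milne's product polarization `Σᵢ prᵢ^* h`, and Cor. 4.5 on
`A^{a+1}` (§1) concludes. The transport between the abelian variety `A^{a+1} = A.powSucc a` and the scheme power
`A.X^{×(a+1)}` (`AbelianVariety.powSucc_X_eq_cartesianPow`, `…dim_powSucc_eq_cartesianPowDim`) is the lane's `castAut`,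
by `subst`.

## What is NOT here

* The equality `S(A^{a+1}) = S(A)` of the TANNAKA-FREE groups themselves (`specialLefschetzGroup` of the power versus the
  image `g ↦ G_a` of that of `A`): it needs "`g ∈ specialLefschetzGroup` acts on `Hᵏ` as `⋀ᵏ(g₁)`" (injectivity of
  `g ↦ g₁` on `S(A)`), which the tree has for the algebraic / motivated / absolute Hodge stabilisers
  (`Summits/…/Ring2HypothesesDescentAbsoluteExteriorLefschetz` §L1) but not for `S(A)`; §2 is what Cor. 4.7 is USED for
  (Prop. 4.8 on the powers) and does not need it.
* Cor. 4.7 for products of non-isogenous factors (binary case: the lane's `LefschetzGroupProducts`); the `k`-structure and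
  `ℓ`-adic realisations (only `ℂ`-points and Betti cohomology, as everywhere in the lane).

## References

* [Milne1999LefschetzClasses] J. S. Milne, Lefschetz classes on abelian varieties, Duke Math. J. 96 (1999) 639–675:
  §1 p. 643 (`C(A^r) = C(A)`), §4 Thm. 4.4, Cor. 4.5, p. 659 (`ker l(A) = S(A)`), Cor. 4.7, Prop. 4.8 and its proof (p. 660).
* [Gordon1999HodgeAVSurvey] B. B. Gordon, A survey of the Hodge conjecture for abelian varieties (1999), Thm. 7.5 (1),
  Def. 7.6, Rem. 7.6.1 (stable nondegeneracy).
* [vanGeemen1994HodgeAV] B. van Geemen, An introduction to the Hodge conjecture for abelian varieties, LNM 1594 (1994),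
  §2.4–2.5 (`B = D`).
* [LangeBirkenhake1992] Ch. Birkenhake, H. Lange, Complex Abelian Varieties (1992), §5.3 (product polarizations).
* [HatcherAT2002] A. Hatcher, Algebraic Topology (2002), §3.2 Thm. 3.16 (Künneth).
-/

noncomputable section

open CategoryTheory MonoidalCategory CartesianMonoidalCategory
open Literature.AlgebraicTopology.SingularHomology
open Literature.AlgebraicGeometry.HodgeTheory
open Literature.AlgebraicGeometry.Motives
open Literature.AlgebraicGeometry.VanGeemen1994 (hodgeClassSpan)
open Literature.Barriers.HodgeConjecture (divisorClassesSpan)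
open Literature.Geometry.Kaehler (lefschetzPow)

namespace Literature.AlgebraicGeometry.Milne1999

/-! ### §1 Cor. 4.5 on the power `A^{a+1}` through `S(A)(ℂ)`: the `⋀•(u^{⊕(a+1)})`-invariants are Lefschetz -/

section PowersInvariants

variable {A : AbelianVariety ℂ} {h : complexBetti A.X 2}

/-- **The classes of `H^{2p}(A^{a+1}(ℂ); ℂ)` fixed by `⋀^{2p}(u^{⊕(a+1)})` for all `u ∈ S(A)(ℂ)` are Lefschetz classes of
`A^{a+1}`** (`0 < dim A`; `h ∈ B¹(A) ⊗ ℂ` with `h^{dim A} ≠ 0` and `Q_h` non-degenerate): by the lane's Cor. 4.7 on `H¹`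
(`exists_mem_unitaryCentralizerGroup_diagPow_eq`) these automorphisms are ALL of `S(A^{a+1})(ℂ)` for the product polarization `Σᵢ prᵢ^* h` (which lies in `B¹(A^{a+1}) ⊗ ℂ` with non-degenerate
pairing, `powPolarizationClass_mem_hodgeClassSpan`, `eq_zero_of_forall_polarizationPairingOne_powPolarizationClass_eq_zero`),
and the `S(A^{a+1})(ℂ)`-invariants are Lefschetz (Thm. 3.2 / Cor. 4.5 on `A^{a+1}`, the lane's
`mem_divisorClassesSpan_of_forall_mem_unitaryCentralizerGroup`). [cite: Milne1999LefschetzClasses, Cor. 4.5 and Cor. 4.7 (p. 659), Thm. 3.2 (p. 653)] -/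
theorem mem_divisorClassesSpan_powSucc_of_forall_diagPowExterior_apply_eq (hA0 : 0 < A.dim)
    (hh : h ∈ hodgeClassSpan A.dim A.X 1) (htop : lefschetzPow h (A.dim - 1) 2 h ≠ 0)
    (hnd : ∀ x : complexBetti A.X 1, (∀ y, polarizationPairingOne A.X h (A.dim - 1) x y = 0) → x = 0)
    (a p : ℕ) (x : complexBetti (A.powSucc a).X (2 * p))
    (hx : ∀ u ∈ unitaryCentralizerGroup A h, diagPowExterior A u a (2 * p) x = x) :
    x ∈ divisorClassesSpan (A.powSucc a).X (A.powSucc a).dim p := by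
  refine mem_divisorClassesSpan_of_forall_mem_unitaryCentralizerGroup (A.powSucc a)
    (powPolarizationClass_mem_hodgeClassSpan hh a)
    (eq_zero_of_forall_polarizationPairingOne_powPolarizationClass_eq_zero hA0 htop hnd a) p x fun U hU ↦ ?_
  obtain ⟨u, hu, rfl⟩ := exists_mem_unitaryCentralizerGroup_diagPow_eq hA0 htop a U hU
  have e := hx u hu
  rwa [diagPowExterior, exteriorPullbackEquiv_apply] at e

end PowersInvariants

/-! ### §2 Cor. 4.5 for all `r`, Tannaka-free: the classes on `A.X^{×(a+1)}` fixed by `S(A)` are the Lefschetz classes -/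

section Tannaka

/-- Transport of "`F`-invariant classes are Lefschetz" along an identification `Y = Y'` of `ℂ`-schemes and `N = N'` of
dimensions (used with `AbelianVariety.powSucc_X_eq_cartesianPow`, `…dim_powSucc_eq_cartesianPowDim`; private plumbing,
by `subst`, matching the lane's `castAut`). [folklore] -/
private theorem mem_divisorClassesSpan_of_castAut {Y Y' : SchemeOver ℂ} (e : Y = Y') {N N' : ℕ} (hN : N = N')
    {ι : Type*} (F : ι → ∀ k : ℕ, complexBetti Y k ≃ₗ[ℂ] complexBetti Y k) (p : ℕ)
    (hY : ∀ y : complexBetti Y (2 * p), (∀ i, F i (2 * p) y = y) → y ∈ divisorClassesSpan Y N p)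
    (x : complexBetti Y' (2 * p)) (hx : ∀ i, castAut e (F i) (2 * p) x = x) :
    x ∈ divisorClassesSpan Y' N' p := by
  subst e hN
  exact hY x hx

/-- **Milne 1999, Cor. 4.5 for every power, Tannaka-free: "these are precisely the classes fixed by" `L(A)`.** For a
complex abelian variety `A`, every `a`, `p` and every class `x ∈ H^{2p}(A.X^{×(a+1)}(ℂ); ℂ)`: if `x` is fixed by the `a`-th
member `G_a` of the Künneth family of every `g` in the special Lefschetz group `specialLefschetzGroup (dim A) A.X` (the
diagonal action of `S(A) = ker l(A)` on the cohomology of the power; `L(A) = w(𝔾_m) · S(A)` acts on `H^{2p}(p)` through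
`S(A)`), then `x` is a LEFSCHETZ class of `A^{a+1}`: `x ∈ lefschetzPowClasses (dim A) A.X a p = D^p_hom(A^{a+1})_ℂ`.
The case `a = 0` is the lane's discharged record `Milne1999_specialLefschetzGroup_invariants_le`; the general case is
Cor. 4.5 on `A^{a+1}` with Cor. 4.7 (§1), see the module docstring for the proof.
[cite: Milne1999LefschetzClasses, Cor. 4.5 (p. 659), Cor. 4.7, and the proof of Prop. 4.8 (p. 660)] -/
theorem mem_lefschetzPowClasses_of_forall_kunnethFamily_apply_eq (A : AbelianVariety ℂ) {a p : ℕ}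
    {x : complexBetti (cartesianPow A.X (a + 1)) (2 * p)}
    (hx : ∀ g ∈ specialLefschetzGroup A.dim A.X,
      ∀ G : ∀ b k : ℕ, complexBetti (cartesianPow A.X (b + 1)) k ≃ₗ[ℂ] complexBetti (cartesianPow A.X (b + 1)) k,
        IsKunnethFamily A.X G → G 0 = g → G a (2 * p) x = x) :
    x ∈ lefschetzPowClasses A.dim A.X a p := by
  change x ∈ divisorClassesSpan (cartesianPow A.X (a + 1)) (cartesianPowDim A.dim a) p
  rcases Nat.eq_zero_or_pos A.dim with hA | hA0
  · -- `dim A = 0`: on `A^{a+1}` (dimension `0`) every class of degree `0` is a multiple of `1`, higher degrees vanish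
    have hp : p = 0 ∨ (A.powSucc a).dim < p := by
      rcases Nat.eq_zero_or_pos p with rfl | hp
      · exact Or.inl rfl
      · refine Or.inr ?_
        rw [A.dim_powSucc_eq_cartesianPowDim, cartesianPowDim_eq, hA, mul_zero]
        exact hp
    exact mem_divisorClassesSpan_of_castAut (A.powSucc_X_eq_cartesianPow a) (A.dim_powSucc_eq_cartesianPowDim a)
      (fun i : Empty ↦ i.elim) p (fun y _ ↦ mem_divisorClassesSpan_of_eq_zero_or_lt (A.powSucc a) hp y) x
      fun i ↦ i.elim
  · -- `0 < dim A`: polarize `A` by the rational Kähler class of a projective embedding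
    obtain ⟨D⟩ := nonempty_kaehlerRationalDatum (AbelianVariety.isSmoothProjective_holds (A := A))
    have hK1 : IsKaehlerClass A.dim A.X (((1 : ℝ) : ℂ) • D.Hη) := by
      rw [Complex.ofReal_one, one_smul]
      exact D.isKaehlerClassVia.isKaehlerClass D.isNatural D.isMultiplicative
    have hnd := eq_zero_of_forall_polarizationPairingOne_eq_zero_of_isKaehlerClass_smul' one_ne_zero hK1
    have hh : D.Hη ∈ hodgeClassSpan A.dim A.X 1 :=
      mem_hodgeClassSpan_one_of_isKaehlerClass_smul D.isRationalClass_Hη one_ne_zero hK1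
    have htop : lefschetzPow D.Hη (A.dim - 1) 2 D.Hη ≠ 0 := lefschetzPow_self_ne_zero_of_isKaehlerClass_smul hA0 hK1
    refine mem_divisorClassesSpan_of_castAut (A.powSucc_X_eq_cartesianPow a) (A.dim_powSucc_eq_cartesianPowDim a)
      (fun u : unitaryCentralizerGroup A D.Hη ↦
        diagPowExterior A (u : complexBetti A.X 1 ≃ₗ[ℂ] complexBetti A.X 1) a) p
      (fun y hy ↦ mem_divisorClassesSpan_powSucc_of_forall_diagPowExterior_apply_eq hA0 hh htop hnd a p y
        fun u hu ↦ hy ⟨u, hu⟩) x fun u ↦ ?_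
    -- `(⋀ᵏu)_k ∈ S(A)` with Künneth family `⋀•(u^{⊕(b+1)})` (Thm. 4.4 `⊇`, the lane), whose `a`-th member fixes `x`
    exact hx _ (exteriorPullbackEquiv_mem_specialLefschetzGroup hA0 hh htop hnd u.2) (exteriorKunnethFamily A u)
      (isKunnethFamily_exteriorKunnethFamily A u) (exteriorKunnethFamily_zero A u)

/-- **Cor. 4.5 on the power `A^{a+1}` as an equality of sets, Tannaka-free**: the classes of `H^{2p}(A.X^{×(a+1)}(ℂ); ℂ)`
fixed by (the Künneth families of) the special Lefschetz group of `A` are EXACTLY the Lefschetz classes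
`D^p_hom(A^{a+1})_ℂ` ("`H^{2*}(A^r)(*)^{L(A)} = D_hom(A^r)_k`" for all `r`; `⊇` is the definition of the group together with the
uniqueness of Künneth families, `IsKunnethFamily.ext_of_apply_zero`). [cite: Milne1999LefschetzClasses, Cor. 4.5 (p. 659)] -/
theorem setOf_forall_kunnethFamily_apply_eq_eq_lefschetzPowClasses (A : AbelianVariety ℂ) (a p : ℕ) :
    {x : complexBetti (cartesianPow A.X (a + 1)) (2 * p) | ∀ g ∈ specialLefschetzGroup A.dim A.X,
      ∀ G : ∀ b k : ℕ, complexBetti (cartesianPow A.X (b + 1)) k ≃ₗ[ℂ] complexBetti (cartesianPow A.X (b + 1)) k,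
        IsKunnethFamily A.X G → G 0 = g → G a (2 * p) x = x} = lefschetzPowClasses A.dim A.X a p := by
  refine Set.Subset.antisymm (fun x hx ↦ mem_lefschetzPowClasses_of_forall_kunnethFamily_apply_eq A hx)
    fun x hx g hg G hG h0 ↦ ?_
  have hg' : g ∈ powClassStabilizer A.X (lefschetzPowClasses A.dim A.X) := hg
  obtain ⟨G', hG', h0', hfix⟩ := hg'
  rw [IsKunnethFamily.ext_of_apply_zero AbelianVariety.isSmoothProjective_holds hG hG' (h0.trans h0'.symm)]
  exact hfix a p x hx

/-- **The criterion behind Prop. 4.8, for ANY system of classes on the powers**: for a complex abelian variety `A` and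
`T = (T_{a,p} ⊆ H^{2p}(A.X^{×(a+1)}(ℂ); ℂ))`, the special Lefschetz group lies in the stabiliser of `T`
(`HodgeTheory.powClassStabilizer`) iff every class of `T` is a Lefschetz class — `⟸` because stabilisers are antitone, `⟹` by
Cor. 4.5 on the powers, §2 (the Künneth family of `g ∈ S(A) ≤ Stab(T)` provided by `Stab(T)` is THE Künneth family of `g`).
With `T` = Hodge classes this is Prop. 4.8 (a) ⟺ (c); with André's motivated classes, the absolute Hodge classes or the
algebraic classes it prices `G¹_mot(A) = S(A)`, `G¹_AH(A) = S(A)`, `G¹_alg(A) = S(A)`.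
[cite: Milne1999LefschetzClasses, Prop. 4.8 (proof, p. 660) and Cor. 4.5] [cite: Andre1996Motifs, §4.6 (ii) (p. 24)] -/
theorem specialLefschetzGroup_le_powClassStabilizer_iff (A : AbelianVariety ℂ)
    (T : ∀ a p : ℕ, Set (complexBetti (cartesianPow A.X (a + 1)) (2 * p))) :
    specialLefschetzGroup A.dim A.X ≤ powClassStabilizer A.X T ↔ ∀ a p, T a p ⊆ lefschetzPowClasses A.dim A.X a p := by
  refine ⟨fun hle a p x hx ↦ ?_, fun hT ↦ powClassStabilizer_anti hT⟩
  refine mem_lefschetzPowClasses_of_forall_kunnethFamily_apply_eq A fun g hg G hG h0 ↦ ?_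
  obtain ⟨G', hG', h0', hfix⟩ := hle hg
  rw [IsKunnethFamily.ext_of_apply_zero AbelianVariety.isSmoothProjective_holds hG hG' (h0.trans h0'.symm)]
  exact hfix a p x hx

/-- **The equality form**: for a system `T` whose stabiliser is a priori INSIDE `S(A)` (e.g. `T ⊇` the Lefschetz classes:
Hodge classes, motivated classes, absolute Hodge classes, algebraic classes), `Stab(T) = S(A)` iff every class of `T` on
every power is Lefschetz. [cite: Milne1999LefschetzClasses, Prop. 4.8 (proof, p. 660)] -/
theorem powClassStabilizer_eq_specialLefschetzGroup_iff (A : AbelianVariety ℂ)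
    {T : ∀ a p : ℕ, Set (complexBetti (cartesianPow A.X (a + 1)) (2 * p))}
    (hT : powClassStabilizer A.X T ≤ specialLefschetzGroup A.dim A.X) :
    powClassStabilizer A.X T = specialLefschetzGroup A.dim A.X ↔ ∀ a p, T a p ⊆ lefschetzPowClasses A.dim A.X a p := by
  rw [← specialLefschetzGroup_le_powClassStabilizer_iff]
  exact ⟨fun h ↦ h.ge, fun h ↦ le_antisymm hT h⟩

end Tannaka

/-! ### §3 Prop. 4.8: (c) ⇒ (a) on every power, (a) ⟺ (c), (a) ⟺ (b) -/

section Prop48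

variable (A : AbelianVariety ℂ)

/-- **Milne Prop. 4.8, (c) ⇒ (a) ON ALL POWERS**: if `Hg′(A) = S(A)` then NO power `A^{a+1}` supports an exotic Hodge class
(`IsDivisorGenerated (A.powSucc a)`: every rational `(p,p)`-class of `A^{a+1}` is a Lefschetz class) — the rational
`(p,p)`-classes of the powers are the classes fixed by `Hg′(A)` (definition, `HodgeTheory.hodgeGroup`), hence by `S(A)`, hence
Lefschetz (§2). The lane's `AbelianVariety.isDivisorGenerated_of_hodgeGroup_eq_specialLefschetzGroup` is the case `a = 0`.
[cite: Milne1999LefschetzClasses, Prop. 4.8 (p. 660)] [cite: Gordon1999HodgeAVSurvey, Thm. 7.5 (1) and Def. 7.6] -/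
theorem _root_.Literature.AlgebraicGeometry.Motives.AbelianVariety.forall_isDivisorGenerated_powSucc_of_hodgeGroup_eq_specialLefschetzGroup
    (h : hodgeGroup A.dim A.X = specialLefschetzGroup A.dim A.X) : ∀ a, IsDivisorGenerated (A.powSucc a) :=
  forall_isDivisorGenerated_powSucc_iff.2
    ((specialLefschetzGroup_le_powClassStabilizer_iff A (hodgePowClasses A.dim A.X)).1 h.ge)

/-- **Milne Prop. 4.8, (a) ⟺ (c), in full**: `Hg′(A) = S(A)` iff no power of `A` supports an exotic Hodge class
(`∀ a, IsDivisorGenerated (A.powSucc a)` — Gordon's / Moonen–Zarhin's "stably nondegenerate", the tree's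
`IsStablyNondegenerate A` by `Iff.rfl`). (`⟸` is the lane's `…_of_forall_isDivisorGenerated`.)
[cite: Milne1999LefschetzClasses, Prop. 4.8 (p. 660)] [cite: Gordon1999HodgeAVSurvey, Thm. 7.5 (1) and Def. 7.6] -/
theorem _root_.Literature.AlgebraicGeometry.Motives.AbelianVariety.hodgeGroup_eq_specialLefschetzGroup_iff_forall_isDivisorGenerated :
    hodgeGroup A.dim A.X = specialLefschetzGroup A.dim A.X ↔ ∀ a, IsDivisorGenerated (A.powSucc a) :=
  ⟨A.forall_isDivisorGenerated_powSucc_of_hodgeGroup_eq_specialLefschetzGroup,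
    A.hodgeGroup_eq_specialLefschetzGroup_of_forall_isDivisorGenerated⟩

/-- **Milne Prop. 4.8, (a) ⟺ (b), in full** (positive dimension): `Hg(A) = L(A)` iff no power of `A` supports an exotic
Hodge class ((b) ⟺ (c) is the lane's `AbelianVariety.hodgeGroup_eq_specialLefschetzGroup_iff`, "the Five Lemma").
[cite: Milne1999LefschetzClasses, Prop. 4.8 (p. 660)] -/
theorem _root_.Literature.AlgebraicGeometry.Motives.AbelianVariety.mumfordTateGroup_eq_lefschetzGroup_iff_forall_isDivisorGenerated
    (hA : 1 ≤ A.dim) :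
    mumfordTateGroup A.dim A.X = lefschetzGroup A.dim A.X ↔ ∀ a, IsDivisorGenerated (A.powSucc a) :=
  (A.hodgeGroup_eq_specialLefschetzGroup_iff hA).symm.trans A.hodgeGroup_eq_specialLefschetzGroup_iff_forall_isDivisorGenerated

/-- **Under Milne's (c), every power of `A` satisfies the Hodge conjecture** — its Hodge classes are Lefschetz, and
Lefschetz classes of an abelian variety are algebraic (Lefschetz `(1,1)` and cup products; the tree's
`hodgeConjectureFor_of_isDivisorGenerated`). UNCONDITIONAL. [cite: Milne1999LefschetzClasses, Prop. 4.8 (p. 660)]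
[cite: vanGeemen1994HodgeAV, §2.4] -/
theorem hodgeConjectureFor_powSucc_of_hodgeGroup_eq_specialLefschetzGroup
    (h : hodgeGroup A.dim A.X = specialLefschetzGroup A.dim A.X) (a : ℕ) :
    HodgeConjectureFor (A.powSucc a).dim (A.powSucc a).X :=
  hodgeConjectureFor_of_isDivisorGenerated _ (A.forall_isDivisorGenerated_powSucc_of_hodgeGroup_eq_specialLefschetzGroup h a)

end Prop48

end Literature.AlgebraicGeometry.Milne1999

end
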